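import Summits.NavierStokesRegularity.FunctionalMining.NoGo.TopEigHeatInverseGap
import HarnessLib

/-!
# FunctionalMining / NoGo — K67: TRANSPORT AT LEVEL `q` and the TWO-CHANNEL FLOOR on everywhere-simple
# fields of `T³` — `Φ_q(v) = −∫ v·div(λ₁^{q−1}P₁)`, `∫ [q(q−1)λ₁^{q−2}|∇λ₁|² + w_q|∇P₁|²] ≤ heat Φ_q v`

HONEST FRAMING. Search for candidate a priori estimates; no regularity claim. Nothing about
Navier–Stokes is proved or asserted in this file. Cell `pub-nsfunc`, no-go seat (gen 54). Door (e) box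
of `NOGO.md` (STRUCTURE ONLY): constraints on the SHAPE of a killing family for the open node
Lemma L-λ(q) = `TopEigHeatCoercivePos q` (door (b)/(F2) wants `¬ TopEigHeatCoercivePos q`: smooth
divergence-free `v_n` on `T³` with `heatDissipation Φ_q v_n ≤ c_n Φ_q(v_n)`, `c_n → 0`;
`Φ_q = torusTopEigMoment q = ∫ (λ₁⁺)^q`, `λ₁ ≥ λ₂ ≥ λ₃` the strain eigenvalues).
SETTING (as in K65 `NoGo.TopEigHeatInverseGap`). `v` smooth, divergence free on `T³`, top strain
eigenvalue SIMPLE AT EVERY POINT (so `λ₁ > 0` and `λ₁` is smooth); `P₁ = topProj v = u₀ ⊗ u₀`;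
`|∇P₁|² = Σₖᵢⱼ (∂ₖ(P₁)ᵢⱼ)²`, `|∇λ₁|² = Σₖ (∂ₖλ₁)²`; gap weight `w_q = qλ₁^{q−1}(λ₁ − λ₂)`.
CONTENT. K65/K66 transported `λ₁ = tr(S P₁)` and obtained rules for `Φ₁ = ∫ λ₁`. This file transports
the `q`-TH POWER ITSELF, `λ₁^q = tr(S · λ₁^{q−1}P₁)`, so that the rules of the sequel
(`NoGo.TopEigHeatChannelRule`) speak about `Φ_q`, the quantity the kill ratio `heat/Φ_q` is made of,
and it keeps BOTH channels of the tree's exact heat formula (F1 PART I Cor. 3′ (a),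
`heatDissipation_topEigMoment_eq_integral_of_simple`), where K65 § 4 kept only the frame channel:
§ 0 **`torusTopEigMoment_eq_integral_rpow_of_simple`**: `Φ_q(v) = ∫ λ₁^q` (every real `q`).
§ 1 TRANSPORT IDENTITY AT LEVEL `q` **`topEigMoment_eq_neg_integral_transport_rpow`**:
`Φ_q(v) = −∫ Σⱼ vⱼ Σᵢ ∂ᵢ(λ₁^{q−1}(P₁)ᵢⱼ)` (every real `q`; integration by parts entrywise).
§ 2 **`abs_transport_rpow_topProj_le`** (pointwise, every real `q`):
`|Σⱼ vⱼ Σᵢ ∂ᵢ(λ₁^{q−1}(P₁)ᵢⱼ)| ≤ ‖v‖ (|q−1| λ₁^{q−2} |∇λ₁| + √3 λ₁^{q−1} |∇P₁|)`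
(product rule, `Σᵢⱼ vⱼ∂ᵢλ₁(u₀)ᵢ(u₀)ⱼ = (∇λ₁·u₀)(v·u₀)` with `|u₀| = 1`, K65's `|v·div P₁| ≤ √3‖v‖|∇P₁|`).
§ 3 TWO-CHANNEL FLOOR **`integral_channels_le_heatDissipation`** (`q ≥ 1`):
`∫ [q(q−1)λ₁^{q−2}|∇λ₁|² + w_q|∇P₁|²] ≤ heatDissipation Φ_q v` (K65 § 1 inside the exact formula; both
channels are non-negative, the amplitude channel `q(q−1)λ₁^{q−2}|∇λ₁|²` is the one K65 § 4 discarded).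
MEANING. §§ 1–3 are the two halves of a Cauchy–Schwarz pairing at level `q`: the sequel combines them into
`Φ_q(v)² ≤ [((q−1)/q)∫‖v‖²λ₁^{q−2} + (3/q)∫‖v‖²λ₁^{q−1}/(λ₁ − λ₂)] · heatDissipation Φ_q v` (R15).
NOT CLAIMED: fields with eigenvalue crossings (door-(e) seam designs are not everywhere simple: across a
seam `P₁` jumps and § 1 acquires seam terms — pen remark); any sign of `heatDissipation` beyond the
tree's; any verdict on L-λ(q): OPEN in the kernel for every real `q > 1`; (F2) WANTED/OPEN; no node
decided. [ours = §§ 0–3 as stated; folklore = integration by parts on `T³`, `∂(f^r) = r f^{r−1}∂f`,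
Cauchy–Schwarz — via the tree and Mathlib]
FILING (prove seat g31, REQUEST #96): declarations byte-identical to the no-go seat's staged `TopEigHeatMomentTransport.STAGING.lean` 0fb51990445aa0c7; this line is the only addition.
-/

noncomputable section

open Filter Topology Matrix Finset MeasureTheory
open scoped ContDiff

namespace Summit.NavierStokesRegularity.FunctionalMining

open Literature.Analysis Literature.Analysis.FunctionSpaces Literature.Analysis.FunctionSpaces.Torus
  SharpClass.DirectorForm Literature.Analysis.Matrix

namespace TopEig.InverseGap

variable {v : UnitAddTorus (Fin 3) → EuclideanSpace ℝ (Fin 3)} {q : ℝ}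

/-- Gap form at every point, in the `∃`-shape the tree's simple-case theorems take. [tree, bookkeeping] -/
private theorem gapForm_of_simple'
    (hsimple : ∀ x : UnitAddTorus (Fin 3), torusStrainMidEig v x < torusStrainTopEig v x)
    (x : UnitAddTorus (Fin 3)) :
    ∃ (e : Fin 3 → ℝ) (lam g : ℝ), e ⬝ᵥ e = 1 ∧ torusStrainMatrix v x *ᵥ e = lam • e ∧ 0 < g ∧
      ∀ w, w ⬝ᵥ e = 0 → w ⬝ᵥ torusStrainMatrix v x *ᵥ w ≤ (lam - g) * (w ⬝ᵥ w) :=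
  let ⟨e, he1, hSe, hg, hgap⟩ := exists_gapForm_of_midEig_lt_topEig (hsimple x)
  ⟨e, _, _, he1, hSe, hg, hgap⟩

/-- `λ₁ > 0` everywhere on an everywhere-simple divergence-free field. [tree] -/
private theorem topEig_pos' (hv : Torus.IsSmooth v) (hdiv : Torus.IsDivFree v)
    (hsimple : ∀ x : UnitAddTorus (Fin 3), torusStrainMidEig v x < torusStrainTopEig v x)
    (x : UnitAddTorus (Fin 3)) : 0 < torusStrainTopEig v x := by
  obtain ⟨e, he1, hSe, hg, hgap⟩ := exists_gapForm_of_midEig_lt_topEig (hsimple x)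
  exact (lam_pos_of_gapForm_of_isDivFree hv hdiv he1 hSe hg hgap).2

/-- `∂ᵢ(vⱼ) = (∂ᵢ v)ⱼ`. [folklore] -/
private theorem partialDeriv_coord'' (hv : Torus.IsSmooth v) (i j : Fin 3) (x : UnitAddTorus (Fin 3)) :
    Torus.partialDeriv i (fun y => v y j) x = Torus.partialDeriv i v x j :=
  Torus.partialDeriv_clm_comp hv (EuclideanSpace.proj j : EuclideanSpace ℝ (Fin 3) →L[ℝ] ℝ) i x

/-- Integration by parts on `T³` for smooth scalars: `∫ (∂ᵢa) b = −∫ a ∂ᵢb`. [folklore] -/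
private theorem integral_partialDeriv_mul_eq_neg'' {a b : UnitAddTorus (Fin 3) → ℝ}
    (ha : Torus.IsSmooth a) (hb : Torus.IsSmooth b) (i : Fin 3) :
    ∫ x, Torus.partialDeriv i a x * b x = -∫ x, a x * Torus.partialDeriv i b x := by
  have h0 := integral_partialDeriv_eq_zero_holds (ha.smul' hb) i
  simp_rw [partialDeriv_smul (ha.isContDiff (by simp)) (hb.isContDiff (by simp)), smul_eq_mul] at h0
  have h1 : Integrable fun x => a x * Torus.partialDeriv i b x :=
    (ha.continuous.mul (hb.partialDeriv i).continuous).integrable_unitAddTorus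
  have h2 : Integrable fun x => Torus.partialDeriv i a x * b x :=
    ((ha.partialDeriv i).continuous.mul hb.continuous).integrable_unitAddTorus
  rw [integral_add h1 h2] at h0
  linarith

/-- `∂ₖ(f^r) = r f^{r−1} ∂ₖf` for a positive smooth scalar on `T³` (chain rule along the coordinate line).
[folklore] -/
private theorem partialDeriv_rpow_of_pos'' {f : UnitAddTorus (Fin 3) → ℝ} (hf : Torus.IsSmooth f)
    (hpos : ∀ y, 0 < f y) (r : ℝ) (k : Fin 3) (y : UnitAddTorus (Fin 3)) :
    Torus.partialDeriv k (fun z => f z ^ r) y = r * f y ^ (r - 1) * Torus.partialDeriv k f y := by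
  have h1 := hasDerivAt_comp_add_proj_smul (hf.isContDiff (by simp)) y (EuclideanSpace.single k 1) 0
  have h2 := h1.rpow_const (p := r) (Or.inl (hpos _).ne')
  simp only [zero_smul, Torus.proj_zero, add_zero] at h2
  simp only [Torus.partialDeriv, Torus.lineDeriv] at h2 ⊢
  rw [h2.deriv]
  ring

/-- **§ 0 `Φ_q(v) = ∫ λ₁^q`** on an everywhere-simple divergence-free field (`λ₁ > 0` everywhere).
[ours, bookkeeping] -/
theorem torusTopEigMoment_eq_integral_rpow_of_simple (hv : Torus.IsSmooth v) (hdiv : Torus.IsDivFree v)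
    (hsimple : ∀ x : UnitAddTorus (Fin 3), torusStrainMidEig v x < torusStrainTopEig v x) (q : ℝ) :
    torusTopEigMoment q v = ∫ x, torusStrainTopEig v x ^ q := by
  have hpos := topEig_pos' hv hdiv hsimple
  unfold torusTopEigMoment
  exact integral_congr_ae (ae_of_all _ fun x => by simp only [max_eq_left (hpos x).le])

/-- **§ 1 TRANSPORT IDENTITY AT LEVEL `q`: `Φ_q(v) = −∫ Σⱼ vⱼ Σᵢ ∂ᵢ(λ₁^{q−1}(P₁)ᵢⱼ)`** on an
everywhere-simple smooth divergence-free field (`λ₁^q = λ₁^{q−1}·Σᵢⱼ(∂ᵢv)ⱼ(P₁)ᵢⱼ`, integration by parts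
entrywise; every real `q`). [ours] -/
theorem topEigMoment_eq_neg_integral_transport_rpow (hv : Torus.IsSmooth v) (hdiv : Torus.IsDivFree v)
    (hsimple : ∀ x : UnitAddTorus (Fin 3), torusStrainMidEig v x < torusStrainTopEig v x) (q : ℝ) :
    torusTopEigMoment q v = -∫ x, ∑ j, v x j *
      ∑ i, Torus.partialDeriv i (fun y => torusStrainTopEig v y ^ (q - 1) * topProj v y i j) x := by
  have hP : ∀ i j, Torus.IsSmooth (fun y => topProj v y i j) := isSmooth_topProj_entry hv hsimple
  have hvj : ∀ j, Torus.IsSmooth (fun y => v y j) := fun j => hv.apply j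
  have hpos := topEig_pos' hv hdiv hsimple
  have hls : Torus.IsSmooth (torusStrainTopEig v) :=
    isSmooth_torusStrainTopEig_of_simple hv (gapForm_of_simple' hsimple)
  have hr : Torus.IsSmooth (fun y => torusStrainTopEig v y ^ (q - 1)) :=
    isSmooth_rpow_of_pos hls hpos (q - 1)
  have hQ : ∀ i j, Torus.IsSmooth (fun y => torusStrainTopEig v y ^ (q - 1) * topProj v y i j) :=
    fun i j => by simpa only [smul_eq_mul] using hr.smul' (hP i j)
  have hpt : ∀ x, torusStrainTopEig v x ^ q = ∑ i, ∑ j, Torus.partialDeriv i (fun y => v y j) x *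
      (torusStrainTopEig v x ^ (q - 1) * topProj v x i j) := by
    intro x
    have h2 := topEig_eq_sum_partialDeriv_mul_topProj (v := v) x
    calc torusStrainTopEig v x ^ q = torusStrainTopEig v x ^ (q - 1) * torusStrainTopEig v x := by
          rw [Real.rpow_sub_one (hpos x).ne', div_mul_cancel₀ _ (hpos x).ne']
      _ = torusStrainTopEig v x ^ (q - 1) *
          ∑ i, ∑ j, Torus.partialDeriv i v x j * topProj v x i j := by rw [← h2]
      _ = _ := by
          simp_rw [Finset.mul_sum, partialDeriv_coord'' hv]
          exact Finset.sum_congr rfl fun i _ => Finset.sum_congr rfl fun j _ => by ring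
  have hint1 : ∀ i j, Integrable fun x => Torus.partialDeriv i (fun y => v y j) x *
      (torusStrainTopEig v x ^ (q - 1) * topProj v x i j) :=
    fun i j => (((hvj j).partialDeriv i).continuous.mul (hQ i j).continuous).integrable_unitAddTorus
  have hint2 : ∀ i j, Integrable fun x => v x j *
      Torus.partialDeriv i (fun y => torusStrainTopEig v y ^ (q - 1) * topProj v y i j) x :=
    fun i j => ((hvj j).continuous.mul ((hQ i j).partialDeriv i).continuous).integrable_unitAddTorus
  have hL : torusTopEigMoment q v = ∑ i, ∑ j, ∫ x, Torus.partialDeriv i (fun y => v y j) x *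
      (torusStrainTopEig v x ^ (q - 1) * topProj v x i j) := by
    rw [torusTopEigMoment_eq_integral_rpow_of_simple hv hdiv hsimple]
    simp_rw [hpt]
    rw [integral_finsetSum _ fun i _ => integrable_finsetSum _ fun j _ => hint1 i j]
    exact Finset.sum_congr rfl fun i _ => integral_finsetSum _ fun j _ => hint1 i j
  have hR : ∫ x, ∑ j, v x j * ∑ i, Torus.partialDeriv i
      (fun y => torusStrainTopEig v y ^ (q - 1) * topProj v y i j) x =
      ∑ i, ∑ j, ∫ x, v x j * Torus.partialDeriv i
        (fun y => torusStrainTopEig v y ^ (q - 1) * topProj v y i j) x := by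
    simp_rw [Finset.mul_sum]
    rw [integral_finsetSum _ fun j _ => integrable_finsetSum _ fun i _ => hint2 i j,
      Finset.sum_comm]
    exact Finset.sum_congr rfl fun j _ => integral_finsetSum _ fun i _ => hint2 i j
  rw [hL, hR, ← Finset.sum_neg_distrib]
  refine Finset.sum_congr rfl fun i _ => ?_
  rw [← Finset.sum_neg_distrib]
  exact Finset.sum_congr rfl fun j _ => integral_partialDeriv_mul_eq_neg'' (hvj j) (hQ i j) i

/-- **§ 2 pointwise `|Σⱼ vⱼ Σᵢ ∂ᵢ(λ₁^{q−1}(P₁)ᵢⱼ)| ≤ ‖v‖ (|q−1| λ₁^{q−2} |∇λ₁| + λ₁^{q−1} √3 |∇P₁|)`**: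
product rule, `Σᵢⱼ vⱼ ∂ᵢλ₁ (u₀)ᵢ(u₀)ⱼ = (∇λ₁·u₀)(v·u₀)` with `|u₀| = 1`, and K65's
`abs_transport_topProj_le`. [ours] -/
theorem abs_transport_rpow_topProj_le (hv : Torus.IsSmooth v) (hdiv : Torus.IsDivFree v)
    (hsimple : ∀ x : UnitAddTorus (Fin 3), torusStrainMidEig v x < torusStrainTopEig v x) (q : ℝ)
    (x : UnitAddTorus (Fin 3)) :
    |∑ j, v x j * ∑ i, Torus.partialDeriv i
        (fun y => torusStrainTopEig v y ^ (q - 1) * topProj v y i j) x| ≤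
      ‖v x‖ * (|q - 1| * torusStrainTopEig v x ^ (q - 2) *
          Real.sqrt (∑ k, Torus.partialDeriv k (torusStrainTopEig v) x ^ 2) +
        torusStrainTopEig v x ^ (q - 1) * (Real.sqrt 3 *
          Real.sqrt (∑ k, ∑ i, ∑ j, Torus.partialDeriv k (fun y => topProj v y i j) x ^ 2))) := by
  have hP : ∀ i j, Torus.IsSmooth (fun y => topProj v y i j) := isSmooth_topProj_entry hv hsimple
  have hpos := topEig_pos' hv hdiv hsimple
  have hls : Torus.IsSmooth (torusStrainTopEig v) :=
    isSmooth_torusStrainTopEig_of_simple hv (gapForm_of_simple' hsimple)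
  have hr : Torus.IsSmooth (fun y => torusStrainTopEig v y ^ (q - 1)) :=
    isSmooth_rpow_of_pos hls hpos (q - 1)
  have hexp : ∀ i j, Torus.partialDeriv i
      (fun y => torusStrainTopEig v y ^ (q - 1) * topProj v y i j) x =
      torusStrainTopEig v x ^ (q - 1) * Torus.partialDeriv i (fun y => topProj v y i j) x +
        (q - 1) * torusStrainTopEig v x ^ (q - 2) * Torus.partialDeriv i (torusStrainTopEig v) x *
          topProj v x i j := by
    intro i j
    rw [partialDeriv_mul (a := fun y => torusStrainTopEig v y ^ (q - 1))
      (b := fun y => topProj v y i j) (hr.isContDiff (by simp)) ((hP i j).isContDiff (by simp)),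
      partialDeriv_rpow_of_pos'' hls hpos (q - 1) i x]
    simp only [show q - 1 - 1 = q - 2 by ring]
  have hPu : ∀ i j, topProj v x i j = topVec v x i * topVec v x j := fun i j => rfl
  have hu1 : ∑ j, topVec v x j ^ 2 = 1 := by
    have h := topVec_dotProduct_self v x
    simpa only [dotProduct, sq] using h
  have hsplit : ∑ j, v x j * ∑ i, (torusStrainTopEig v x ^ (q - 1) *
        Torus.partialDeriv i (fun y => topProj v y i j) x +
      (q - 1) * torusStrainTopEig v x ^ (q - 2) * Torus.partialDeriv i (torusStrainTopEig v) x *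
        topProj v x i j) =
      torusStrainTopEig v x ^ (q - 1) *
          (∑ j, v x j * ∑ i, Torus.partialDeriv i (fun y => topProj v y i j) x) +
        (q - 1) * torusStrainTopEig v x ^ (q - 2) *
          ((∑ i, Torus.partialDeriv i (torusStrainTopEig v) x * topVec v x i) *
            ∑ j, v x j * topVec v x j) := by
    simp only [hPu, Fin.sum_univ_three]
    ring
  have ha : |∑ i, Torus.partialDeriv i (torusStrainTopEig v) x * topVec v x i| ≤
      Real.sqrt (∑ k, Torus.partialDeriv k (torusStrainTopEig v) x ^ 2) := by
    refine Real.abs_le_sqrt ?_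
    calc _ ≤ (∑ i, Torus.partialDeriv i (torusStrainTopEig v) x ^ 2) * ∑ i, topVec v x i ^ 2 :=
          Finset.sum_mul_sq_le_sq_mul_sq _ _ _
      _ = _ := by rw [hu1, mul_one]
  have hb : |∑ j, v x j * topVec v x j| ≤ ‖v x‖ := by
    refine (Real.abs_le_sqrt ?_).trans (Real.sqrt_sq (norm_nonneg _)).le
    calc _ ≤ (∑ j, v x j ^ 2) * ∑ j, topVec v x j ^ 2 := Finset.sum_mul_sq_le_sq_mul_sq _ _ _
      _ = _ := by rw [hu1, mul_one, EuclideanSpace.real_norm_sq_eq]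
  have hr1 : 0 ≤ torusStrainTopEig v x ^ (q - 1) := Real.rpow_nonneg (hpos x).le _
  have hr2 : 0 ≤ torusStrainTopEig v x ^ (q - 2) := Real.rpow_nonneg (hpos x).le _
  simp_rw [hexp]
  rw [hsplit]
  refine (abs_add_le _ _).trans ?_
  rw [abs_mul, abs_of_nonneg hr1, abs_mul, abs_mul, abs_of_nonneg hr2, abs_mul]
  calc _ ≤ torusStrainTopEig v x ^ (q - 1) * (‖v x‖ * (Real.sqrt 3 *
          Real.sqrt (∑ k, ∑ i, ∑ j, Torus.partialDeriv k (fun y => topProj v y i j) x ^ 2))) +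
        |q - 1| * torusStrainTopEig v x ^ (q - 2) *
          (Real.sqrt (∑ k, Torus.partialDeriv k (torusStrainTopEig v) x ^ 2) * ‖v x‖) :=
        add_le_add (mul_le_mul_of_nonneg_left (abs_transport_topProj_le x) hr1)
          (mul_le_mul_of_nonneg_left (mul_le_mul ha hb (abs_nonneg _) (Real.sqrt_nonneg _))
            (mul_nonneg (abs_nonneg _) hr2))
    _ = _ := by ring

/-- **§ 3 TWO-CHANNEL FLOOR `∫ [q(q−1)λ₁^{q−2}|∇λ₁|² + w_q|∇P₁|²] ≤ heatDissipation Φ_q v`** (`q ≥ 1`,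
everywhere simple): K65 § 1 inside the tree's exact two-channel heat formula, keeping the amplitude channel
that K65 § 4 discarded. [ours] -/
theorem integral_channels_le_heatDissipation (hq : 1 ≤ q) (hv : Torus.IsSmooth v)
    (hdiv : Torus.IsDivFree v)
    (hsimple : ∀ x : UnitAddTorus (Fin 3), torusStrainMidEig v x < torusStrainTopEig v x) :
    ∫ x, (q * (q - 1) * torusStrainTopEig v x ^ (q - 2) *
        ∑ k, Torus.partialDeriv k (torusStrainTopEig v) x ^ 2 +
      q * torusStrainTopEig v x ^ (q - 1) * (torusStrainTopEig v x - torusStrainMidEig v x) *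
        ∑ k, ∑ i, ∑ j, Torus.partialDeriv k (fun y => topProj v y i j) x ^ 2) ≤
      heatDissipation (torusTopEigMoment q) v := by
  have hgf := gapForm_of_simple' hsimple
  have hpos := topEig_pos' hv hdiv hsimple
  have hls : Torus.IsSmooth (torusStrainTopEig v) := isSmooth_torusStrainTopEig_of_simple hv hgf
  have hl := hls.continuous
  rw [heatDissipation_topEigMoment_eq_integral_of_simple hq hv hdiv hgf]
  have hA : Integrable fun x => q * (q - 1) * torusStrainTopEig v x ^ (q - 2) *
      ∑ k, Torus.partialDeriv k (torusStrainTopEig v) x ^ 2 :=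
    (((hl.rpow_const fun x => Or.inl (hpos x).ne').const_mul _).mul
      (continuous_finsetSum _ fun k _ => (hls.partialDeriv k).continuous.pow 2)).integrable_unitAddTorus
  have hB : Integrable fun x => q * torusStrainTopEig v x ^ (q - 1) *
      Torus.laplacian (torusStrainTopEig v) x :=
    (((hl.rpow_const fun x => Or.inr (by linarith)).const_mul q).mul
      hls.laplacian.continuous).integrable_unitAddTorus
  have hD := integrable_danskinDensity hq hv hv.laplacian hdiv
  have hW : Integrable fun x => q * torusStrainTopEig v x ^ (q - 1) *
      (torusStrainTopEig v x - torusStrainMidEig v x) *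
        ∑ k, ∑ i, ∑ j, Torus.partialDeriv k (fun y => topProj v y i j) x ^ 2 :=
    ((continuous_strainGapWeight hq hv).mul
      (continuous_sum_sq_partialDeriv_topProj hv hsimple)).integrable_unitAddTorus
  refine integral_mono (hA.add hW) ((hA.add (hB.sub hD)).congr (ae_of_all _ fun x => ?_)) fun x => ?_
  · simp only [Pi.add_apply, Pi.sub_apply]
    ring
  · have h1 := gap_mul_sum_sq_partialDeriv_topProj_le hv (hsimple x)
    have hw : 0 ≤ q * torusStrainTopEig v x ^ (q - 1) :=
      mul_nonneg (by linarith) (Real.rpow_nonneg (hpos x).le _)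
    calc _ = q * (q - 1) * torusStrainTopEig v x ^ (q - 2) *
          ∑ k, Torus.partialDeriv k (torusStrainTopEig v) x ^ 2 + q * torusStrainTopEig v x ^ (q - 1) *
          ((torusStrainTopEig v x - torusStrainMidEig v x) *
            ∑ k, ∑ i, ∑ j, Torus.partialDeriv k (fun y => topProj v y i j) x ^ 2) := by ring
      _ ≤ _ := add_le_add le_rfl (mul_le_mul_of_nonneg_left h1 hw)

end TopEig.InverseGap

end Summit.NavierStokesRegularity.FunctionalMining

end
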